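import Literature.NumberTheory.ConnesConsani2021.ProlateEigenvaluePolynomialDecay
import HarnessLib

/-!
# An explicit, index-wise majorant for the prolate eigenvalues `λ(n)` (fixed band-limit `c = 2π`)

RH-FREE corpus literature (label, line 1): classical analysis of Slepian's prolate spheroidal wave
functions at the single band-limit `c = 2π` used by Connes–Consani 2021 §4–§5; nothing in this file
mentions `ζ`, the critical strip or RH, and nothing here bears on the truth of RH.  bears_on (cell
rh-crit, corpus C1): the HIGH-MODE TAIL INPUT of the (E-a) conjunct of `CC2021_section6_enclosures`
(route «ConnesConsaniSemilocal», item K3 `WindowSpectralBound`, stmt 19306): the panel frame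
`section6_enclosures_of_panels` (seat t7, `ArchKernelL1Certificate.lean`) needs a NUMERICALLY SMALL
bound for the tail `Σ_{n ≥ N₁} |τ(n)T_n(ρ)|`, i.e. an explicit majorant of `|λ(n)|` that is already
tiny for `n ≈ 8`.  The tree had only the qualitative `Σ |λ(n)| n² < ∞`
(`summable_abs_prolateEigen_mul_sq`) and Osipov's Theorem 33 (`Osipov2013_thm_33`, a named fact,
numerically vacuous below Osipov-index `≈ 26`).

## What is proved (theorems; the only `def`s are explicit closed-form data with bodies)

For CC's `φ_n = prolateFun n` (the tree prolate function `h_{2n,1}`: `∫_{−1}^{1} φ_n² = 1`,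
`φ_n(0) > 0`, Sturm–Liouville eigenvalue `χ` with Wang's window `2n(2n+1) < χ < 2n(2n+1) + 4π²`) and
`λ(n) = prolateEigen n = (∫_{−1}^{1} φ_n)/φ_n(0)`:

* `X_sq_mul_legendre` — `x² P_m = A_m P_{m+2} + B_m P_m + C_m P_{m−2}` (Bonnet twice), data `legA`,
  `legB`, `legC`;
* `legInt_recurrence` — **the three-term recurrence of the Legendre coefficients**
  `b_m = ∫_{−1}^{1} φ P_m` of ANY tree prolate function at `λ = 1` with eigenvalue `χ`:
  `4π² A_m b_{m+2} = (χ − m(m+1) − 4π² B_m) b_m − 4π² C_m b_{m−2}` (Green symmetry of the prolate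
  operator — tree theorem `IsProlateFunction.eigen_mul_integral_mul_eq` — against `P_m`, Legendre's
  equation and Bonnet's recursion; this is Bouwkamp's recurrence [cite: RokhlinXiao2007, §4;
  Osipov2013, §2.1]);
* `abs_mul_prod_atilde_le` — **forward growth of a three-term recurrence** (elementary): if
  `u_{k+1} = α_k u_k − β_k u_{k−1}`, `β_k ≥ 0`, `α_k ≥ a_k` and the continued-fraction minorants
  `ã_0 = a_0`, `ã_k = a_k − β_k/ã_{k−1}` are positive for `k < K`, then `|u_0| · ∏_{k<K} ã_k ≤ |u_K|`;
* `sq_apply_zero_ge` — **a lower bound for `φ(0)²`**: `φ(0)² ≥ 1/(4π(χ + 1/2))` whenever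
  `χ + 1/4 ≥ 4π²` (so for every `n ≥ 3`), by the Liouville substitution `u = (1−x²)^{1/4}φ` written in
  the `x`-variable: the weighted energy `M(x) = √(1−x²)·N(x)`,
  `N = ((1−x²)φ′ − xφ/2)² + ((χ + ¼ − 4π²x²)(1−x²) + ¼)φ²`, is non-increasing on `[0,1)` and
  `φ² ≤ 4N`, whence `φ(x)² ≤ 4(χ+½)φ(0)²/√(1−x²)` and `½ = ∫_0^1 φ² ≤ 2π(χ+½)φ(0)²`
  [folklore: Sonin–Pólya / Sturm comparison bookkeeping, cf. Szegő, Orthogonal Polynomials, §7.31];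
* `abs_prolateEigen_le_prolateEigenMajorant` — **the explicit majorant**: for `n ≥ 8`,
  `|λ(n)| ≤ prolateEigenMajorant n := √(2/(4n+1)) · √(4π(2n(2n+1) + 39.48 + ½)) / ∏_{k<n} ã_k(n)`
  with the RATIONAL data `a_k(n) = (2n(2n+1) − 2k(2k+1) − Q B_{2k})/(Q A_{2k})`, `Q = 39.48 ≥ 4π²`,
  `β_k = C_{2k}/A_{2k}` (`prolateAlphaLB`, `prolateBeta`), and the positivity `0 < ã_k(n)` for
  `k < n`, `n ≥ 8` (`prolateAtilde_pos`).  Numerically `prolateEigenMajorant 8 ≈ 3.2·10⁻⁸`,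
  `… 9 ≈ 2.6·10⁻¹⁰`, `… 11 ≈ 9·10⁻¹⁵` (the true `λ(n)` are about `100×` smaller; irrelevant here);
  the numeral read-offs and the App. F tail `Σ_{n≥8} |τ(n)T_n(ρ)| ≤ 10⁻³` are left to a companion
  module (seat rh-crit-cc-t15, to follow).

The argument is the fixed-`c` half of the classical Legendre-coefficient analysis of the prolate
functions [cite: RokhlinXiao2007, §4 (analysis of the Legendre expansion); Osipov2013, §2.1–§2.2 and
Thm. 33 (the shape of an explicit super-exponential bound)]; no ordering of the `|λ(n)|`, no
continuation in the band parameter and no lower bound of Osipov's Thm. 9 type is used — the value at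
`x = 0` is controlled by the energy bound above instead.

Sources: A. Connes, C. Consani, Selecta Math. 27 (2021) 77 = arXiv:2006.13771 [bib `ConnesConsani2021`]
§4 p. 16 (the `λ(n)`), App. F; V. Rokhlin, H. Xiao, Appl. Comput. Harmon. Anal. 22 (2007) 105–123
[bib `RokhlinXiao2007`] §4; A. Osipov, Appl. Comput. Harmon. Anal. 35 (2013) 309–340 [bib `Osipov2013`];
L.-L. Wang, Math. Comp. 79 (2010) Lemma 2.2 [bib `WangLL2010`].

WHAT THIS FILE IS NOT: a statement about `ζ` or RH; an asymptotic (the bound is crude by a factor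
`≈ 100` but explicit).  Nothing here bears on the truth of RH.
-/

noncomputable section

open Real Set MeasureTheory Filter Topology Polynomial

namespace Literature.NumberTheory.ConnesConsani2021

open Literature.NumberTheory.LFunctions
open Literature.Analysis.SpecialFunctions (legendre legendre_zero legendre_one X_mul_legendre
  integral_legendre_sq derivative_one_sub_X_sq_mul_derivative_legendre)

/-! ## §1 `x² P_m` on the Legendre basis -/

/-- RH-FREE datum. `A_m = (m+1)(m+2)/((2m+1)(2m+3))`, the coefficient of `P_{m+2}` in `x² P_m`.
[cite: RokhlinXiao2007, §4 (Legendre three-term recursion); Osipov2013, §2.1] -/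
def legA (m : ℕ) : ℝ := ((m : ℝ) + 1) * ((m : ℝ) + 2) / ((2 * (m : ℝ) + 1) * (2 * (m : ℝ) + 3))

/-- RH-FREE datum. `B_m = (m+1)²/((2m+1)(2m+3)) + m²/((2m+1)(2m−1))`, the coefficient of `P_m` in
`x² P_m`. [cite: RokhlinXiao2007, §4; Osipov2013, §2.1] -/
def legB (m : ℕ) : ℝ :=
  ((m : ℝ) + 1) ^ 2 / ((2 * (m : ℝ) + 1) * (2 * (m : ℝ) + 3)) +
    (m : ℝ) ^ 2 / ((2 * (m : ℝ) + 1) * (2 * (m : ℝ) - 1))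

/-- RH-FREE datum. `C_m = m(m−1)/((2m+1)(2m−1))`, the coefficient of `P_{m−2}` in `x² P_m`.
[cite: RokhlinXiao2007, §4; Osipov2013, §2.1] -/
def legC (m : ℕ) : ℝ := (m : ℝ) * ((m : ℝ) - 1) / ((2 * (m : ℝ) + 1) * (2 * (m : ℝ) - 1))

/-- `2m+1 ≠ 0`. [folklore] -/
private theorem two_mul_natCast_add_one_ne (m : ℕ) : (2 * (m : ℝ) + 1) ≠ 0 := by positivity

/-- `2m+3 ≠ 0`. [folklore] -/
private theorem two_mul_natCast_add_three_ne (m : ℕ) : (2 * (m : ℝ) + 3) ≠ 0 := by positivity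

/-- `2m−1 ≠ 0` for a natural number `m`. [folklore] -/
private theorem two_mul_natCast_sub_one_ne (m : ℕ) : (2 * (m : ℝ) - 1) ≠ 0 := by
  intro h
  have h2 : (2 * m : ℝ) = 1 := by linarith
  have h3 : (2 * m : ℕ) = 1 := by exact_mod_cast h2
  omega

/-- **`x² P_m = A_m P_{m+2} + B_m P_m + C_m P_{m−2}`** (Bonnet's recursion applied twice; at `m = 0, 1`
the last term is absent since `C_0 = C_1 = 0`). [cite: RokhlinXiao2007, §4; Osipov2013, §2.1 (three-term recursion of the normalized Legendre polynomials)] -/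
theorem X_sq_mul_legendre (m : ℕ) :
    X ^ 2 * legendre m =
      C (legA m) * legendre (m + 2) + C (legB m) * legendre m + C (legC m) * legendre (m - 2) := by
  apply Polynomial.funext
  intro x
  have h1 := congrArg (fun p => p.eval x) (X_mul_legendre m)
  have h2 := congrArg (fun p => p.eval x) (X_mul_legendre (m + 1))
  simp only [eval_mul, eval_C, eval_X, eval_add, Nat.add_sub_cancel] at h1 h2
  have hne1 := two_mul_natCast_add_one_ne m
  have hne3 := two_mul_natCast_add_three_ne m
  have hnem := two_mul_natCast_sub_one_ne m
  rcases m with _ | m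
  · -- `m = 0`: `x² = (2/3) P_2 + 1/3`
    simp only [eval_mul, eval_pow, eval_X, eval_C, eval_add, legA, legB, legC, CharP.cast_eq_zero,
      legendre_zero, eval_one, Nat.zero_sub] at h1 h2 ⊢
    simp only [legendre_one, eval_X, zero_add, Nat.reduceAdd] at h1 h2 ⊢
    norm_num at h1 h2 ⊢
    nlinarith [h1, h2]
  · have h0 := congrArg (fun p => p.eval x) (X_mul_legendre m)
    simp only [eval_mul, eval_C, eval_X, eval_add] at h0
    have hne0 := two_mul_natCast_add_one_ne m
    simp only [eval_mul, eval_pow, eval_X, eval_C, eval_add, legA, legB, legC, Nat.add_sub_cancel,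
      show m + 1 + 2 = m + 3 from rfl, show m + 1 + 1 = m + 2 from rfl,
      show m + 1 - 2 = m - 1 from rfl] at h1 h2 h0 ⊢
    push_cast at h1 h2 h0 hne1 hne3 hnem hne0 ⊢
    have hne5 : (2 * ((m : ℝ) + 2) + 1) ≠ 0 := by positivity
    -- `x·(x P_{m+1}) = x·(a P_{m+2} + b P_m)`, then expand `x P_{m+2}` and `x P_m`
    have e1 : x ^ 2 * eval x (legendre (m + 1)) =
        ((m : ℝ) + 1 + 1) / (2 * ((m : ℝ) + 1) + 1) * (x * eval x (legendre (m + 2))) +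
          ((m : ℝ) + 1) / (2 * ((m : ℝ) + 1) + 1) * (x * eval x (legendre m)) := by
      rw [show x ^ 2 * eval x (legendre (m + 1)) = x * (x * eval x (legendre (m + 1))) by ring, h1]
      ring
    rw [e1, h2, h0, show (2 * ((m : ℝ) + 1) - 1) = 2 * (m : ℝ) + 1 by ring]
    field_simp
    ring

/-- Legendre's equation evaluated: `−((1−x²)P_m″(x) − 2xP_m′(x)) = m(m+1)P_m(x)`.
[cite: RokhlinXiao2007, §2 (Legendre's differential equation)] -/
theorem neg_legendreOp_eval (m : ℕ) (x : ℝ) :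
    -((1 - x ^ 2) * (derivative (derivative (legendre m))).eval x -
        2 * x * (derivative (legendre m)).eval x) =
      (m : ℝ) * (m + 1) * (legendre m).eval x := by
  have h := congrArg (fun p => p.eval x) (derivative_one_sub_X_sq_mul_derivative_legendre m)
  simp only [derivative_mul, derivative_sub, derivative_one, derivative_X_pow, zero_sub, eval_add,
    eval_mul, eval_neg, eval_sub, eval_one, eval_pow, eval_X, eval_C, Nat.cast_ofNat,
    Nat.add_one_sub_one, pow_one] at h
  linear_combination -h

/-! ## §2 The Legendre coefficients of a prolate function and their three-term recurrence -/

/-- RH-FREE datum. `b_m(f) = ∫_{−1}^{1} f(x) P_m(x) dx`, the (un-normalised) `m`-th Legendre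
coefficient of `f`. [cite: RokhlinXiao2007, §4 (Legendre expansion of `ψ_n`); Osipov2013, §2.1] -/
def legInt (f : ℝ → ℝ) (m : ℕ) : ℝ := ∫ x in (-1 : ℝ)..1, f x * (legendre m).eval x

/-- `b_0(f) = ∫_{−1}^{1} f`. [cite: RokhlinXiao2007, §4] -/
theorem legInt_zero (f : ℝ → ℝ) : legInt f 0 = ∫ x in (-1 : ℝ)..1, f x := by
  simp [legInt, legendre_zero]

/-- `f·P_m` is integrable on `[−1,1]`. [folklore] -/
private theorem intervalIntegrable_mul_legendre {N : ℕ} {f : ℝ → ℝ} (hf : IsProlateFunction 1 N f)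
    (m : ℕ) : IntervalIntegrable (fun x ↦ f x * (legendre m).eval x) volume (-1) 1 := by
  refine ContinuousOn.intervalIntegrable_of_Icc (by norm_num) ?_
  have hfc : ContinuousOn f (Icc (-1) 1) := by simpa using hf.contDiffOn.continuousOn
  exact hfc.mul (Polynomial.continuous _).continuousOn

/-- **Bouwkamp's three-term recurrence for the Legendre coefficients of a prolate function** (fixed
band-limit `c = 2π`): for a tree prolate function `f` at `λ = 1` with Sturm–Liouville eigenvalue `χ`,
`4π² A_m b_{m+2} = (χ − m(m+1) − 4π² B_m) b_m − 4π² C_m b_{m−2}` for every `m` (at `m = 0, 1` the last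
term vanishes).  Proof: Green symmetry `χ∫ f P_m = ∫ f · L P_m` (tree theorem
`IsProlateFunction.eigen_mul_integral_mul_eq`), `L P_m = m(m+1)P_m + 4π²x²P_m`, and `X_sq_mul_legendre`.
[cite: RokhlinXiao2007, §4 (three-term recursion for the Legendre coefficients of `ψ_n`); Osipov2013, §2.1; SlepianPollak1961, §III] -/
theorem legInt_recurrence {N : ℕ} {f : ℝ → ℝ} (hf : IsProlateFunction 1 N f) {χ : ℝ}
    (hχ : ∀ x ∈ Ioo (-1 : ℝ) 1,
      -(deriv (fun y ↦ (1 ^ 2 - y ^ 2) * deriv f y) x) + (2 * π * 1 * x) ^ 2 * f x = χ * f x)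
    (m : ℕ) :
    4 * π ^ 2 * legA m * legInt f (m + 2) =
      (χ - (m : ℝ) * (m + 1) - 4 * π ^ 2 * legB m) * legInt f m - 4 * π ^ 2 * legC m * legInt f (m - 2) := by
  have hG := hf.eigen_mul_integral_mul_eq hχ (g := fun x ↦ (legendre m).eval x)
    (g₁ := fun x ↦ (derivative (legendre m)).eval x)
    (g₂ := fun x ↦ (derivative (derivative (legendre m))).eval x)
    (fun x ↦ Polynomial.hasDerivAt _ x) (fun x ↦ Polynomial.hasDerivAt _ x) (Polynomial.continuous _)
  have hX := fun x : ℝ ↦ congrArg (fun p => p.eval x) (X_sq_mul_legendre m)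
  simp only [eval_mul, eval_pow, eval_X, eval_add, eval_C] at hX
  have hpt : ∀ x : ℝ,
      f x * (-((1 ^ 2 - x ^ 2) * (derivative (derivative (legendre m))).eval x -
          2 * x * (derivative (legendre m)).eval x) + (2 * π * 1 * x) ^ 2 * (legendre m).eval x) =
        ((m : ℝ) * (m + 1) + 4 * π ^ 2 * legB m) * (f x * (legendre m).eval x) +
          4 * π ^ 2 * legA m * (f x * (legendre (m + 2)).eval x) +
          4 * π ^ 2 * legC m * (f x * (legendre (m - 2)).eval x) := by
    intro x
    rw [one_pow, neg_legendreOp_eval m x,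
      show (2 * π * 1 * x) ^ 2 * (legendre m).eval x = 4 * π ^ 2 * (x ^ 2 * (legendre m).eval x) by
        ring, hX x]
    ring
  simp_rw [hpt] at hG
  have i0 := intervalIntegrable_mul_legendre hf m
  have i2 := intervalIntegrable_mul_legendre hf (m + 2)
  have im := intervalIntegrable_mul_legendre hf (m - 2)
  rw [intervalIntegral.integral_add ((i0.const_mul _).add (i2.const_mul _)) (im.const_mul _),
    intervalIntegral.integral_add (i0.const_mul _) (i2.const_mul _),
    intervalIntegral.integral_const_mul, intervalIntegral.integral_const_mul,
    intervalIntegral.integral_const_mul] at hG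
  simp only [legInt]
  linarith

/-! ## §3 Forward growth of a three-term recurrence (elementary) -/

/-- RH-FREE datum. The **continued-fraction minorants** `ã_0 = a_0`, `ã_{k+1} = a_{k+1} − β_{k+1}/ã_k`
of a three-term recurrence `u_{k+1} = α_k u_k − β_k u_{k−1}` with `α_k ≥ a_k`.
[cite: RokhlinXiao2007, §4 (growth of the Legendre coefficients below the turning point); Osipov2013, §2.2] -/
def atilde (a β : ℕ → ℝ) : ℕ → ℝ
  | 0 => a 0
  | k + 1 => a (k + 1) - β (k + 1) / atilde a β k

/-- `ã_0 = a_0`. [cite: RokhlinXiao2007, §4 (recurrence analysis); Osipov2013, §2.2] -/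
@[simp] theorem atilde_zero (a β : ℕ → ℝ) : atilde a β 0 = a 0 := rfl

/-- `ã_{k+1} = a_{k+1} − β_{k+1}/ã_k`. [cite: RokhlinXiao2007, §4 (recurrence analysis); Osipov2013, §2.2] -/
theorem atilde_succ (a β : ℕ → ℝ) (k : ℕ) :
    atilde a β (k + 1) = a (k + 1) - β (k + 1) / atilde a β k := rfl

/-- `ã_k ≤ a_k` when `β ≥ 0` and the previous minorant is positive. [cite: RokhlinXiao2007, §4] -/
theorem atilde_le (a β : ℕ → ℝ) (hβ : ∀ k, 0 ≤ β k) {k : ℕ}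
    (hpos : ∀ j < k, 0 < atilde a β j) : atilde a β k ≤ a k := by
  rcases k with _ | k
  · simp
  · rw [atilde_succ]
    have := hpos k (Nat.lt_succ_self k)
    have : 0 ≤ β (k + 1) / atilde a β k := div_nonneg (hβ _) this.le
    linarith

/-- The growth step, positive case: if `u_0 > 0` then `ã_k u_k ≤ u_{k+1}` and `u_k > 0` for `k < K`.
[cite: RokhlinXiao2007, §4; Osipov2013, §2.2] -/
theorem atilde_mul_le_succ_of_pos {u α β a : ℕ → ℝ} {K : ℕ} (h1 : u 1 = α 0 * u 0)
    (hrec : ∀ k, 1 ≤ k → u (k + 1) = α k * u k - β k * u (k - 1)) (hβ : ∀ k, 0 ≤ β k)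
    (ha : ∀ k < K, a k ≤ α k) (hpos : ∀ k < K, 0 < atilde a β k) (hu : 0 < u 0) :
    ∀ k < K, atilde a β k * u k ≤ u (k + 1) ∧ 0 < u k := by
  intro k
  induction k with
  | zero =>
    intro hK
    refine ⟨?_, hu⟩
    rw [atilde_zero, h1]
    exact mul_le_mul_of_nonneg_right (ha 0 hK) hu.le
  | succ k ih =>
    intro hK
    obtain ⟨hk1, hk2⟩ := ih (Nat.lt_of_succ_lt hK)
    have hak := hpos k (Nat.lt_of_succ_lt hK)
    have huk1 : 0 < u (k + 1) := lt_of_lt_of_le (mul_pos hak hk2) hk1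
    refine ⟨?_, huk1⟩
    have hle : u k ≤ u (k + 1) / atilde a β k := by
      rw [le_div_iff₀ hak]; linarith [mul_comm (atilde a β k) (u k)]
    rw [atilde_succ, hrec (k + 1) le_add_self, Nat.add_sub_cancel]
    have hβk := hβ (k + 1)
    have e1 : β (k + 1) * u k ≤ β (k + 1) * (u (k + 1) / atilde a β k) :=
      mul_le_mul_of_nonneg_left hle hβk
    have e2 : a (k + 1) * u (k + 1) ≤ α (k + 1) * u (k + 1) :=
      mul_le_mul_of_nonneg_right (ha (k + 1) hK) huk1.le
    have e3 : (a (k + 1) - β (k + 1) / atilde a β k) * u (k + 1) =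
        a (k + 1) * u (k + 1) - β (k + 1) * (u (k + 1) / atilde a β k) := by ring
    rw [e3]
    linarith

/-- **Forward growth of the recurrence**: `|u_0| · ∏_{k<K} ã_k ≤ |u_K|`.
[cite: RokhlinXiao2007, §4 (the Legendre coefficients of `ψ_n` grow geometrically up to the turning point); Osipov2013, §2.2] -/
theorem abs_mul_prod_atilde_le {u α β a : ℕ → ℝ} {K : ℕ} (h1 : u 1 = α 0 * u 0)
    (hrec : ∀ k, 1 ≤ k → u (k + 1) = α k * u k - β k * u (k - 1)) (hβ : ∀ k, 0 ≤ β k)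
    (ha : ∀ k < K, a k ≤ α k) (hpos : ∀ k < K, 0 < atilde a β k) :
    |u 0| * ∏ k ∈ Finset.range K, atilde a β k ≤ |u K| := by
  -- positive case
  have main : ∀ v : ℕ → ℝ, v 1 = α 0 * v 0 → (∀ k, 1 ≤ k → v (k + 1) = α k * v k - β k * v (k - 1)) →
      0 < v 0 → v 0 * ∏ k ∈ Finset.range K, atilde a β k ≤ v K := by
    intro v hv1 hvrec hv0
    have step := atilde_mul_le_succ_of_pos hv1 hvrec hβ ha hpos hv0
    have : ∀ k ≤ K, v 0 * ∏ j ∈ Finset.range k, atilde a β j ≤ v k := by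
      intro k
      induction k with
      | zero => intro; simp
      | succ k ih =>
        intro hk
        have hkK : k < K := hk
        rw [Finset.prod_range_succ, ← mul_assoc]
        calc v 0 * (∏ j ∈ Finset.range k, atilde a β j) * atilde a β k
            ≤ v k * atilde a β k := mul_le_mul_of_nonneg_right (ih hkK.le) (hpos k hkK).le
          _ ≤ v (k + 1) := by rw [mul_comm]; exact (step k hkK).1
    exact this K le_rfl
  rcases lt_trichotomy (u 0) 0 with hneg | hzero | hposu
  · -- apply to `-u`
    have h := main (fun k ↦ -u k) (by simp [h1]) (fun k hk ↦ by rw [hrec k hk]; ring)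
      (by simpa using hneg)
    rw [abs_of_neg hneg]
    exact h.trans (neg_le_abs _)
  · rw [hzero, abs_zero, zero_mul]; exact abs_nonneg _
  · rw [abs_of_pos hposu]
    exact (main u h1 hrec hposu).trans (le_abs_self _)

/-! ## §4 A lower bound for `φ(0)²` (Liouville substitution, energy monotonicity) -/

/-- `∫_0^1 dx/√(1−x²) = π/2` (the derivative of `arcsin`, integrable although unbounded at `1`).
[folklore] -/
private theorem integral_inv_sqrt_one_sub_sq :
    IntervalIntegrable (fun x : ℝ ↦ 1 / Real.sqrt (1 - x ^ 2)) volume 0 1 ∧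
      ∫ x in (0 : ℝ)..1, 1 / Real.sqrt (1 - x ^ 2) = π / 2 := by
  have hcont : ContinuousOn Real.arcsin (Icc 0 1) := Real.continuous_arcsin.continuousOn
  have hderiv : ∀ x ∈ Ioo (0 : ℝ) 1, HasDerivAt Real.arcsin (1 / Real.sqrt (1 - x ^ 2)) x :=
    fun x hx ↦ Real.hasDerivAt_arcsin (by linarith [hx.1]) hx.2.ne
  have hpos : ∀ x ∈ Ioo (0 : ℝ) 1, 0 ≤ 1 / Real.sqrt (1 - x ^ 2) := fun x _ ↦ by positivity
  have hint : IntervalIntegrable (fun x : ℝ ↦ 1 / Real.sqrt (1 - x ^ 2)) volume 0 1 := by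
    rw [intervalIntegrable_iff_integrableOn_Ioc_of_le zero_le_one]
    exact intervalIntegral.integrableOn_deriv_of_nonneg hcont hderiv hpos
  refine ⟨hint, ?_⟩
  rw [intervalIntegral.integral_eq_sub_of_hasDerivAt_of_le zero_le_one hcont hderiv hint,
    Real.arcsin_one, Real.arcsin_zero, sub_zero]

/-- Half of the normalisation: `∫_0^1 φ² = 1/2` for an (even) tree prolate function at `λ = 1`.
[cite: ConnesConsani2021, §4 p. 16 ("these are even functions", arXiv p0016:L18)] -/
theorem integral_sq_half {N : ℕ} {f : ℝ → ℝ} (hf : IsProlateFunction 1 N f) :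
    ∫ x in (0 : ℝ)..1, f x ^ 2 = 1 / 2 := by
  have hfc : ContinuousOn f (Icc (-1) 1) := by simpa using hf.contDiffOn.continuousOn
  have hsq : ContinuousOn (fun x ↦ f x ^ 2) (Icc (-1) 1) := hfc.pow 2
  have i1 : IntervalIntegrable (fun x ↦ f x ^ 2) volume (-1) 0 :=
    (hsq.mono (Icc_subset_Icc le_rfl zero_le_one)).intervalIntegrable_of_Icc (by norm_num)
  have i2 : IntervalIntegrable (fun x ↦ f x ^ 2) volume 0 1 :=
    (hsq.mono (Icc_subset_Icc (by norm_num) le_rfl)).intervalIntegrable_of_Icc zero_le_one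
  have htot : ∫ x in (-1 : ℝ)..1, f x ^ 2 = 1 := by simpa using hf.norm_one
  have hsplit := intervalIntegral.integral_add_adjacent_intervals i1 i2
  have hneg : ∫ x in (-1 : ℝ)..0, f x ^ 2 = ∫ x in (0 : ℝ)..1, f x ^ 2 := by
    have h1 : ∫ x in (-1 : ℝ)..0, f x ^ 2 = ∫ x in (-1 : ℝ)..0, f (-x) ^ 2 :=
      intervalIntegral.integral_congr fun x _ ↦ by simp [hf.even x]
    rw [h1, intervalIntegral.integral_comp_neg (fun x ↦ f x ^ 2)]
    norm_num
  linarith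

set_option maxHeartbeats 400000 in
/-- RH-FREE. **Lower bound for the central value**: for a tree prolate function `f` at `λ = 1`
(`∫_{−1}^{1} f² = 1`) with Sturm–Liouville eigenvalue `χ ≥ 4π² − 1/4`,
`f(0)² ≥ 1/(4π(χ + 1/2))`.  Proof: with `D = (1−x²)f′ − xf/2`,
`Q = (χ + ¼ − 4π²x²)(1−x²) + ¼ ≥ ¼` and `N = D² + Qf²`, the weighted energy `G = (1−x²)N²`
(the square of the Liouville energy `√(1−x²)·N` of `u = (1−x²)^{1/4}f`) satisfies
`G′ = 2N·(x(f²/2 − 2N) − 8π²x(1−x²)²f²) ≤ 0` on `(0,1)`, so `(1−x²)N(x)² ≤ N(0)² = ((χ+½)f(0)²)²`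
(`f′(0) = 0`), hence `f(x)² ≤ 4N(x) ≤ 4(χ+½)f(0)²/√(1−x²)` and `½ = ∫_0^1 f² ≤ 2π(χ+½)f(0)²`.
(An energy argument of Sonin–Pólya type for the prolate equation.)
[cite: Szego1975, §7.31 Thm. 7.31.1 (Sonin's monotonicity method for `(k y′)′ + φ y = 0`); SlepianPollak1961, §III (the prolate equation)]
-- TODO(general form): arbitrary band parameter `λ` (`IsProlateFunction lam`); only `λ = 1` is consumed.
-/
theorem sq_apply_zero_ge {N : ℕ} {f : ℝ → ℝ} (hf : IsProlateFunction 1 N f) {χ : ℝ}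
    (hχ : ∀ x ∈ Ioo (-1 : ℝ) 1,
      -(deriv (fun y ↦ (1 ^ 2 - y ^ 2) * deriv f y) x) + (2 * π * 1 * x) ^ 2 * f x = χ * f x)
    (hc : 4 * π ^ 2 ≤ χ + 1 / 4) :
    1 / (4 * π * (χ + 1 / 2)) ≤ f 0 ^ 2 := by
  set f₁ : ℝ → ℝ := derivWithin f (Icc (-1 : ℝ) 1) with hf₁
  -- the objects
  set D : ℝ → ℝ := fun x ↦ (1 ^ 2 - x ^ 2) * f₁ x - x / 2 * f x with hD
  set Q : ℝ → ℝ := fun x ↦ (χ + 1 / 4 - 4 * π ^ 2 * x ^ 2) * (1 - x ^ 2) + 1 / 4 with hQ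
  set Nf : ℝ → ℝ := fun x ↦ D x * D x + Q x * (f x * f x) with hNf
  set G : ℝ → ℝ := fun x ↦ (1 - x ^ 2) * (Nf x * Nf x) with hG
  -- their derivatives on `(-1, 1)`
  set D' : ℝ → ℝ := fun x ↦ ((2 * π * 1 * x) ^ 2 - χ) * f x - (1 / 2 * f x + x / 2 * f₁ x) with hD'
  set Q' : ℝ → ℝ := fun x ↦
    -(4 * π ^ 2 * (2 * x)) * (1 - x ^ 2) + (χ + 1 / 4 - 4 * π ^ 2 * x ^ 2) * (-(2 * x)) with hQ'
  set Nf' : ℝ → ℝ := fun x ↦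
    D' x * D x + D x * D' x + (Q' x * (f x * f x) + Q x * (f₁ x * f x + f x * f₁ x)) with hNf'
  set G' : ℝ → ℝ := fun x ↦
    -(2 * x) * (Nf x * Nf x) + (1 - x ^ 2) * (Nf' x * Nf x + Nf x * Nf' x) with hG'
  have hx2 : ∀ x : ℝ, HasDerivAt (fun y : ℝ ↦ y ^ 2) (2 * x) x := fun x ↦ by
    simpa using hasDerivAt_pow 2 x
  have hGd : ∀ x ∈ Ioo (-1 : ℝ) 1, HasDerivAt G (G' x) x := by
    intro x hx
    have hF := hf.hasDerivAt_flux hχ hx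
    have hf' : HasDerivAt f (f₁ x) x := hf.hasDerivAt_derivWithin hx
    have h2 : HasDerivAt (fun y : ℝ ↦ y / 2 * f y) (1 / 2 * f x + x / 2 * f₁ x) x :=
      ((hasDerivAt_id x).div_const 2).fun_mul hf'
    have hDd : HasDerivAt D (D' x) x := hF.fun_sub h2
    have hQd : HasDerivAt Q (Q' x) x := by
      have h1 : HasDerivAt (fun y : ℝ ↦ χ + 1 / 4 - 4 * π ^ 2 * y ^ 2) (-(4 * π ^ 2 * (2 * x))) x :=
        ((hx2 x).const_mul (4 * π ^ 2)).const_sub (χ + 1 / 4)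
      have h3 : HasDerivAt (fun y : ℝ ↦ 1 - y ^ 2) (-(2 * x)) x := (hx2 x).const_sub 1
      exact (h1.fun_mul h3).add_const (1 / 4)
    have hNd : HasDerivAt Nf (Nf' x) x := (hDd.fun_mul hDd).fun_add (hQd.fun_mul (hf'.fun_mul hf'))
    have hp : HasDerivAt (fun y : ℝ ↦ 1 - y ^ 2) (-(2 * x)) x := (hx2 x).const_sub 1
    exact hp.fun_mul (hNd.fun_mul hNd)
  -- the sign of `G'` on `[0, 1)`
  have hQlb : ∀ x ∈ Ico (0 : ℝ) 1, 1 / 4 ≤ Q x := by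
    intro x hx
    have hx1 : x ^ 2 ≤ 1 := by nlinarith [hx.1, hx.2]
    have h1 : 0 ≤ χ + 1 / 4 - 4 * π ^ 2 * x ^ 2 := by nlinarith [Real.pi_pos]
    have h2 : 0 ≤ 1 - x ^ 2 := by linarith
    have h12 := mul_nonneg h1 h2
    simp only [hQ]
    linarith
  have hNf_ge : ∀ x ∈ Ico (0 : ℝ) 1, f x ^ 2 ≤ 4 * Nf x := by
    intro x hx
    have := hQlb x hx
    simp only [hNf]
    nlinarith [mul_self_nonneg (D x), mul_self_nonneg (f x)]
  have hNf_nn : ∀ x ∈ Ico (0 : ℝ) 1, 0 ≤ Nf x := fun x hx ↦ by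
    have := hNf_ge x hx; nlinarith [sq_nonneg (f x)]
  have hG'le : ∀ x ∈ Ioo (0 : ℝ) 1, G' x ≤ 0 := by
    intro x hx
    have hE1 : G' x = 2 * Nf x * (-x * Nf x + (1 - x ^ 2) * Nf' x) := by
      simp only [hG']; ring
    have hE2 : -x * Nf x + (1 - x ^ 2) * Nf' x =
        x * (f x ^ 2 / 2 - 2 * Nf x) - 8 * π ^ 2 * x * (1 - x ^ 2) ^ 2 * f x ^ 2 := by
      simp only [hNf', hD', hQ', hNf, hD, hQ]
      ring
    rw [hE1, hE2]
    have h1 := hNf_ge x ⟨hx.1.le, hx.2⟩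
    have h2 := hNf_nn x ⟨hx.1.le, hx.2⟩
    have h3 : x * (f x ^ 2 / 2 - 2 * Nf x) ≤ 0 :=
      mul_nonpos_of_nonneg_of_nonpos hx.1.le (by linarith)
    have h4 : 0 ≤ 8 * π ^ 2 * x * (1 - x ^ 2) ^ 2 * f x ^ 2 := by
      have := hx.1.le; positivity
    nlinarith
  -- `G` is non-increasing on `[0,1)`
  have hanti : AntitoneOn G (Ico 0 1) := by
    have hsub : Ico (0 : ℝ) 1 ⊆ Ioo (-1) 1 := fun x hx ↦ ⟨by linarith [hx.1], hx.2⟩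
    refine antitoneOn_of_deriv_nonpos (convex_Ico 0 1) ?_ ?_ ?_
    · exact fun x hx ↦ (hGd x (hsub hx)).continuousAt.continuousWithinAt
    · rw [interior_Ico]
      exact fun x hx ↦ (hGd x ⟨by linarith [hx.1], hx.2⟩).differentiableAt.differentiableWithinAt
    · rw [interior_Ico]
      intro x hx
      rw [(hGd x ⟨by linarith [hx.1], hx.2⟩).deriv]
      exact hG'le x hx
  -- the value at `0`
  have hf₁0 : f₁ 0 = 0 := by
    simp only [hf₁]
    rw [hf.derivWithin_eq_deriv (by simp), hf.deriv_zero]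
  have hNf0 : Nf 0 = (χ + 1 / 2) * f 0 ^ 2 := by
    simp only [hNf, hD, hQ, hf₁0]; ring
  have hG0 : G 0 = ((χ + 1 / 2) * f 0 ^ 2) ^ 2 := by
    simp only [hG]; rw [hNf0]; ring
  have hχpos : 0 < χ + 1 / 2 := by nlinarith [Real.pi_gt_three]
  -- pointwise bound `f(x)² ≤ 4(χ+1/2)f(0)² / √(1−x²)` on `[0,1)`
  have hpt : ∀ x ∈ Ico (0 : ℝ) 1,
      f x ^ 2 ≤ 4 * (χ + 1 / 2) * f 0 ^ 2 * (1 / Real.sqrt (1 - x ^ 2)) := by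
    intro x hx
    have h1x : 0 < 1 - x ^ 2 := by nlinarith [hx.1, hx.2]
    have hs : 0 < Real.sqrt (1 - x ^ 2) := Real.sqrt_pos.2 h1x
    have hGx : G x ≤ G 0 := hanti (by simp) hx hx.1
    rw [hG0] at hGx
    have hb : 0 ≤ (χ + 1 / 2) * f 0 ^ 2 := by positivity
    -- `√(1−x²)·Nf x ≤ (χ+1/2) f(0)²`
    have hle : Real.sqrt (1 - x ^ 2) * Nf x ≤ (χ + 1 / 2) * f 0 ^ 2 := by
      have hsq : (Real.sqrt (1 - x ^ 2) * Nf x) ^ 2 ≤ ((χ + 1 / 2) * f 0 ^ 2) ^ 2 := by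
        rw [mul_pow, Real.sq_sqrt h1x.le]
        have : G x = (1 - x ^ 2) * Nf x ^ 2 := by simp only [hG]; ring
        linarith
      exact (pow_le_pow_iff_left₀ (mul_nonneg hs.le (hNf_nn x hx)) hb two_ne_zero).1 hsq
    have h4 := hNf_ge x hx
    rw [mul_one_div, le_div_iff₀ hs]
    calc f x ^ 2 * Real.sqrt (1 - x ^ 2) ≤ 4 * Nf x * Real.sqrt (1 - x ^ 2) :=
        mul_le_mul_of_nonneg_right h4 hs.le
      _ = 4 * (Real.sqrt (1 - x ^ 2) * Nf x) := by ring
      _ ≤ 4 * ((χ + 1 / 2) * f 0 ^ 2) := by linarith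
      _ = 4 * (χ + 1 / 2) * f 0 ^ 2 := by ring
  -- integrate over `(0,1)`
  obtain ⟨hint, hval⟩ := integral_inv_sqrt_one_sub_sq
  have hfc : ContinuousOn f (Icc (-1) 1) := by simpa using hf.contDiffOn.continuousOn
  have hsqi : IntervalIntegrable (fun x ↦ f x ^ 2) volume 0 1 :=
    ((hfc.pow 2).mono (Icc_subset_Icc (by norm_num) le_rfl)).intervalIntegrable_of_Icc zero_le_one
  have hmono : ∫ x in (0 : ℝ)..1, f x ^ 2 ≤
      ∫ x in (0 : ℝ)..1, 4 * (χ + 1 / 2) * f 0 ^ 2 * (1 / Real.sqrt (1 - x ^ 2)) := by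
    refine intervalIntegral.integral_mono_ae_restrict zero_le_one hsqi (hint.const_mul _) ?_
    have h1 : ∀ᵐ x : ℝ ∂volume, x ∉ ({1} : Set ℝ) :=
      measure_eq_zero_iff_ae_notMem.1 (measure_singleton _)
    filter_upwards [ae_restrict_mem measurableSet_Icc, ae_restrict_of_ae h1] with x hx hx1
    exact hpt x ⟨hx.1, lt_of_le_of_ne hx.2 hx1⟩
  rw [integral_sq_half hf, intervalIntegral.integral_const_mul, hval] at hmono
  rw [div_le_iff₀ (by positivity)]
  nlinarith [Real.pi_pos]

/-! ## §5 The explicit majorant for CC's `λ(n)` -/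

/-- Cauchy–Schwarz against a Legendre polynomial: `|b_m(f)| ≤ √(2/(2m+1))` when `∫_{−1}^{1} f² = 1`.
[cite: RokhlinXiao2007, §4 (the normalized Legendre coefficients of a unit vector are at most `1`)] -/
theorem abs_legInt_le {N : ℕ} {f : ℝ → ℝ} (hf : IsProlateFunction 1 N f) (m : ℕ) :
    |legInt f m| ≤ Real.sqrt (2 / (2 * m + 1)) := by
  set g : ℝ → ℝ := fun x ↦ (legendre m).eval x with hg
  set c : ℝ := Real.sqrt (2 / (2 * m + 1)) with hc
  have hcpos : 0 < c := Real.sqrt_pos.2 (by positivity)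
  have hc2 : c ^ 2 = 2 / (2 * m + 1) := Real.sq_sqrt (by positivity)
  have hfc : ContinuousOn f (Icc (-1) 1) := by simpa using hf.contDiffOn.continuousOn
  have hgc : Continuous g := Polynomial.continuous _
  have hle : (-1 : ℝ) ≤ 1 := by norm_num
  have iff : IntervalIntegrable (fun x ↦ f x ^ 2) volume (-1) 1 := (hfc.pow 2).intervalIntegrable_of_Icc hle
  have ifg : IntervalIntegrable (fun x ↦ f x * g x) volume (-1) 1 :=
    (hfc.mul hgc.continuousOn).intervalIntegrable_of_Icc hle
  have igg : IntervalIntegrable (fun x ↦ g x ^ 2) volume (-1) 1 :=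
    (hgc.pow 2).intervalIntegrable (-1) 1
  have hf2 : ∫ x in (-1 : ℝ)..1, f x ^ 2 = 1 := by simpa using hf.norm_one
  have hg2 : ∫ x in (-1 : ℝ)..1, g x ^ 2 = c ^ 2 := by rw [hc2]; exact integral_legendre_sq m
  set I := ∫ x in (-1 : ℝ)..1, f x * g x with hI
  have key : ∀ t : ℝ, 0 ≤ t ^ 2 - 2 * t * I + c ^ 2 := by
    intro t
    have h0 : 0 ≤ ∫ x in (-1 : ℝ)..1, (t * f x - g x) ^ 2 :=
      intervalIntegral.integral_nonneg hle fun x _ ↦ sq_nonneg _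
    have hexp : ∫ x in (-1 : ℝ)..1, (t * f x - g x) ^ 2 =
        t ^ 2 * (∫ x in (-1 : ℝ)..1, f x ^ 2) - 2 * t * I + ∫ x in (-1 : ℝ)..1, g x ^ 2 := by
      have e : ∀ x : ℝ, (t * f x - g x) ^ 2 = t ^ 2 * f x ^ 2 - 2 * t * (f x * g x) + g x ^ 2 :=
        fun x ↦ by ring
      simp_rw [e]
      rw [intervalIntegral.integral_add ((iff.const_mul _).sub (ifg.const_mul _)) igg,
        intervalIntegral.integral_sub (iff.const_mul _) (ifg.const_mul _),
        intervalIntegral.integral_const_mul, intervalIntegral.integral_const_mul]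
    rw [hexp, hf2, hg2] at h0
    linarith
  have h1 := key c
  have h2 := key (-c)
  have hIeq : legInt f m = I := rfl
  rw [hIeq, abs_le]
  constructor <;> nlinarith

/-- RH-FREE datum. `Q = 39.48`, a rational upper bound for `4π²` (`π < 3.1416`). [folklore] -/
def fourPiSqUB : ℝ := 987 / 25

/-- `4π² ≤ 39.48`. [folklore] -/
private theorem four_pi_sq_le_fourPiSqUB : 4 * π ^ 2 ≤ fourPiSqUB := by
  have := Real.pi_lt_d4
  have h0 := Real.pi_pos
  rw [fourPiSqUB]
  nlinarith

/-- RH-FREE datum. **The minorants `a_k(n)` of the recurrence ratios** at CC-index `n` (Sturm index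
`2n`, `χ > 2n(2n+1)`): `a_k(n) = (2n(2n+1) − 2k(2k+1) − Q·B_{2k})/(Q·A_{2k})`, `Q = 39.48`.
[cite: RokhlinXiao2007, §4; WangLL2010, Lemma 2.2 (the window for `χ`)] -/
def prolateAlphaLB (n k : ℕ) : ℝ :=
  (2 * (n : ℝ) * (2 * n + 1) - 2 * (k : ℝ) * (2 * k + 1) - fourPiSqUB * legB (2 * k)) /
    (fourPiSqUB * legA (2 * k))

/-- RH-FREE datum. `β_k = C_{2k}/A_{2k}` (band-limit free). [cite: RokhlinXiao2007, §4] -/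
def prolateBeta (k : ℕ) : ℝ := legC (2 * k) / legA (2 * k)

/-- RH-FREE datum. The continued-fraction minorants `ã_k(n)` for CC-index `n`. [cite: RokhlinXiao2007, §4] -/
def prolateAtilde (n : ℕ) : ℕ → ℝ := atilde (prolateAlphaLB n) prolateBeta

/-- RH-FREE datum. **The explicit majorant** of `|λ(n)|`:
`R(n) = √(2/(4n+1)) · √(4π(2n(2n+1) + Q + ½)) / ∏_{k<n} ã_k(n)`.
[cite: RokhlinXiao2007, §4; Osipov2013, Thm. 33 (shape of an explicit bound)] -/
def prolateEigenMajorant (n : ℕ) : ℝ :=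
  Real.sqrt (2 / (4 * n + 1)) * Real.sqrt (4 * π * (2 * n * (2 * n + 1) + fourPiSqUB + 1 / 2)) /
    ∏ k ∈ Finset.range n, prolateAtilde n k

/-! ### Elementary bounds on the Legendre data -/

/-- `A_m > 0`. [cite: DLMF, 18.9.1 (Legendre three-term recurrence; elementary consequence for its coefficients)] -/
theorem legA_pos (m : ℕ) : 0 < legA m := by unfold legA; positivity

/-- `A_m ≤ 12/35` for `m ≥ 2`. [cite: DLMF, 18.9.1 (Legendre three-term recurrence; elementary consequence for its coefficients)] -/
theorem legA_le (m : ℕ) (hm : 2 ≤ m) : legA m ≤ 12 / 35 := by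
  have hm' : (2 : ℝ) ≤ m := by exact_mod_cast hm
  rw [legA, div_le_div_iff₀ (by positivity) (by norm_num)]
  nlinarith

/-- `A_0 = 2/3`. [cite: DLMF, 18.9.1 (Legendre three-term recurrence; elementary consequence for its coefficients)] -/
theorem legA_zero : legA 0 = 2 / 3 := by norm_num [legA]

/-- `B_0 = 1/3`. [cite: DLMF, 18.9.1 (Legendre three-term recurrence; elementary consequence for its coefficients)] -/
theorem legB_zero : legB 0 = 1 / 3 := by norm_num [legB]

/-- `C_0 = 0`. [cite: DLMF, 18.9.1 (Legendre three-term recurrence; elementary consequence for its coefficients)] -/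
theorem legC_zero : legC 0 = 0 := by norm_num [legC]

/-- `0 ≤ B_m`. [cite: DLMF, 18.9.1 (Legendre three-term recurrence; elementary consequence for its coefficients)] -/
theorem legB_nonneg (m : ℕ) : 0 ≤ legB m := by
  rcases Nat.eq_zero_or_pos m with rfl | hm
  · rw [legB_zero]; norm_num
  · have hm' : (1 : ℝ) ≤ m := by exact_mod_cast hm
    unfold legB
    have : 0 < 2 * (m : ℝ) - 1 := by linarith
    positivity

/-- `B_m ≤ 11/21` for `m ≥ 2`. [cite: DLMF, 18.9.1 (Legendre three-term recurrence; elementary consequence for its coefficients)] -/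
theorem legB_le (m : ℕ) (hm : 2 ≤ m) : legB m ≤ 11 / 21 := by
  have hm' : (2 : ℝ) ≤ m := by exact_mod_cast hm
  have h1 : ((m : ℝ) + 1) ^ 2 / ((2 * (m : ℝ) + 1) * (2 * (m : ℝ) + 3)) ≤ 9 / 35 := by
    rw [div_le_div_iff₀ (by positivity) (by norm_num)]; nlinarith
  have h2 : (m : ℝ) ^ 2 / ((2 * (m : ℝ) + 1) * (2 * (m : ℝ) - 1)) ≤ 4 / 15 := by
    have : 0 < 2 * (m : ℝ) - 1 := by linarith
    rw [div_le_div_iff₀ (by positivity) (by norm_num)]; nlinarith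
  unfold legB
  linarith

/-- `0 ≤ C_m`. [cite: DLMF, 18.9.1 (Legendre three-term recurrence; elementary consequence for its coefficients)] -/
theorem legC_nonneg (m : ℕ) : 0 ≤ legC m := by
  rcases Nat.eq_zero_or_pos m with rfl | hm
  · rw [legC_zero]
  · have hm' : (1 : ℝ) ≤ m := by exact_mod_cast hm
    unfold legC
    have : 0 < 2 * (m : ℝ) - 1 := by linarith
    have : 0 ≤ (m : ℝ) - 1 := by linarith
    positivity

/-- `C_m ≤ A_m`. [cite: DLMF, 18.9.1 (Legendre three-term recurrence; elementary consequence for its coefficients)] -/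
theorem legC_le_legA (m : ℕ) : legC m ≤ legA m := by
  rcases Nat.eq_zero_or_pos m with rfl | hm
  · rw [legC_zero]; exact (legA_pos 0).le
  · have hm' : (1 : ℝ) ≤ m := by exact_mod_cast hm
    have h1 : 0 < 2 * (m : ℝ) - 1 := by linarith
    unfold legC legA
    rw [div_le_div_iff₀ (by positivity) (by positivity)]
    nlinarith [mul_pos h1 (by positivity : (0 : ℝ) < 2 * m + 3)]

/-- `0 ≤ β_k ≤ 1`. [cite: DLMF, 18.9.1 (Legendre three-term recurrence; elementary consequence for its coefficients)] -/
theorem prolateBeta_nonneg (k : ℕ) : 0 ≤ prolateBeta k :=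
  div_nonneg (legC_nonneg _) (legA_pos _).le

/-- `β_k ≤ 1`. [cite: DLMF, 18.9.1 (Legendre three-term recurrence; elementary consequence for its coefficients)] -/
theorem prolateBeta_le_one (k : ℕ) : prolateBeta k ≤ 1 :=
  (div_le_one (legA_pos _)).2 (legC_le_legA _)

/-- `β_0 = 0`. [cite: DLMF, 18.9.1 (Legendre three-term recurrence; elementary consequence for its coefficients)] -/
theorem prolateBeta_zero : prolateBeta 0 = 0 := by simp [prolateBeta, legC_zero]

/-- `a_k(n) ≥ 2` for `1 ≤ k < n`, `n ≥ 7` (numerator `≥ 8n − 2 − Q·11/21`, denominator `≤ Q·12/35`).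
[cite: WangLL2010, Lemma 2.2; RokhlinXiao2007, §4] -/
theorem two_le_prolateAlphaLB {n k : ℕ} (hn : 7 ≤ n) (hk : 1 ≤ k) (hkn : k < n) :
    2 ≤ prolateAlphaLB n k := by
  have hk2 : 2 ≤ 2 * k := by omega
  have hA := legA_le (2 * k) hk2
  have hApos := legA_pos (2 * k)
  have hB := legB_le (2 * k) hk2
  have hn' : (7 : ℝ) ≤ n := by exact_mod_cast hn
  have hkn' : (k : ℝ) + 1 ≤ n := by exact_mod_cast hkn
  have hk' : (1 : ℝ) ≤ k := by exact_mod_cast hk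
  -- `2n(2n+1) − 2k(2k+1) ≥ 8n − 2`
  have hgap : 8 * (n : ℝ) - 2 ≤ 2 * (n : ℝ) * (2 * n + 1) - 2 * (k : ℝ) * (2 * k + 1) := by nlinarith
  rw [prolateAlphaLB, le_div_iff₀ (by rw [fourPiSqUB]; positivity), fourPiSqUB]
  nlinarith

/-- `a_0(n) ≥ 1` for `n ≥ 3`. [cite: WangLL2010, Lemma 2.2] -/
theorem one_le_prolateAlphaLB_zero {n : ℕ} (hn : 3 ≤ n) : 1 ≤ prolateAlphaLB n 0 := by
  have hn' : (3 : ℝ) ≤ n := by exact_mod_cast hn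
  rw [prolateAlphaLB, Nat.mul_zero, legA_zero, legB_zero, fourPiSqUB, le_div_iff₀ (by norm_num)]
  push_cast
  nlinarith

/-- **Positivity of the minorants**: `ã_k(n) ≥ 1` for `k < n`, `n ≥ 8` (induction: `ã_0 = a_0 ≥ 1`,
`ã_{k+1} ≥ a_{k+1} − β_{k+1}/ã_k ≥ 2 − 1`). [cite: RokhlinXiao2007, §4] -/
theorem one_le_prolateAtilde {n : ℕ} (hn : 8 ≤ n) : ∀ k < n, 1 ≤ prolateAtilde n k := by
  intro k
  induction k with
  | zero =>
    intro _
    rw [prolateAtilde, atilde_zero]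
    exact one_le_prolateAlphaLB_zero (by omega)
  | succ k ih =>
    intro hk
    have h1 := ih (Nat.lt_of_succ_lt hk)
    rw [prolateAtilde, atilde_succ, ← prolateAtilde.eq_def] at *
    have h2 := two_le_prolateAlphaLB (n := n) (by omega) (Nat.succ_le_succ (Nat.zero_le k)) hk
    have h3 : prolateBeta (k + 1) / prolateAtilde n k ≤ 1 := by
      rw [div_le_one (by linarith)]
      exact (prolateBeta_le_one _).trans h1
    rw [prolateAtilde] at h3 ⊢
    linarith

/-- `0 < ã_k(n)` for `k < n`, `n ≥ 8`. [cite: RokhlinXiao2007, §4] -/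
theorem prolateAtilde_pos {n : ℕ} (hn : 8 ≤ n) {k : ℕ} (hk : k < n) : 0 < prolateAtilde n k :=
  lt_of_lt_of_le one_pos (one_le_prolateAtilde hn k hk)

/-- `0 < ∏_{k<n} ã_k(n)` for `n ≥ 8`. [cite: RokhlinXiao2007, §4] -/
theorem prod_prolateAtilde_pos {n : ℕ} (hn : 8 ≤ n) : 0 < ∏ k ∈ Finset.range n, prolateAtilde n k :=
  Finset.prod_pos fun _ hk ↦ prolateAtilde_pos hn (Finset.mem_range.1 hk)

/-- `0 < R(n)` for `n ≥ 8`. [cite: RokhlinXiao2007, §4] -/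
theorem prolateEigenMajorant_pos {n : ℕ} (hn : 8 ≤ n) : 0 < prolateEigenMajorant n := by
  unfold prolateEigenMajorant
  have := prod_prolateAtilde_pos hn
  have : 0 < fourPiSqUB := by norm_num [fourPiSqUB]
  positivity

/-- The true recurrence ratio dominates its minorant: if `χ > 2n(2n+1)` and `a_k(n) > 0` then
`a_k(n) ≤ α_k = (χ − 2k(2k+1) − 4π²B_{2k})/(4π²A_{2k})`. [cite: WangLL2010, Lemma 2.2] -/
theorem prolateAlphaLB_le_alpha {n k : ℕ} {χ : ℝ} (hχ : 2 * (n : ℝ) * (2 * n + 1) < χ)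
    (hpos : 0 < prolateAlphaLB n k) :
    prolateAlphaLB n k ≤
      (χ - 2 * (k : ℝ) * (2 * k + 1) - 4 * π ^ 2 * legB (2 * k)) / (4 * π ^ 2 * legA (2 * k)) := by
  have hQ := four_pi_sq_le_fourPiSqUB
  have hA := legA_pos (2 * k)
  have hB := legB_nonneg (2 * k)
  have hQpos : (0 : ℝ) < fourPiSqUB := by norm_num [fourPiSqUB]
  have hπ : 0 < 4 * π ^ 2 := by positivity
  -- the numerator of `a_k` is positive
  have hnum : 0 < 2 * (n : ℝ) * (2 * n + 1) - 2 * (k : ℝ) * (2 * k + 1) - fourPiSqUB * legB (2 * k) := by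
    have := (div_pos_iff_of_pos_right (mul_pos hQpos hA)).1 hpos
    exact this
  rw [prolateAlphaLB, div_le_div_iff₀ (mul_pos hQpos hA) (mul_pos hπ hA)]
  have h1 : 2 * (n : ℝ) * (2 * n + 1) - 2 * (k : ℝ) * (2 * k + 1) - fourPiSqUB * legB (2 * k) ≤
      χ - 2 * (k : ℝ) * (2 * k + 1) - 4 * π ^ 2 * legB (2 * k) := by nlinarith
  calc (2 * (n : ℝ) * (2 * n + 1) - 2 * (k : ℝ) * (2 * k + 1) - fourPiSqUB * legB (2 * k)) *
        (4 * π ^ 2 * legA (2 * k))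
      ≤ (2 * (n : ℝ) * (2 * n + 1) - 2 * (k : ℝ) * (2 * k + 1) - fourPiSqUB * legB (2 * k)) *
        (fourPiSqUB * legA (2 * k)) := by
          apply mul_le_mul_of_nonneg_left _ hnum.le
          exact mul_le_mul_of_nonneg_right hQ hA.le
    _ ≤ _ := mul_le_mul_of_nonneg_right h1 (mul_pos hQpos hA).le

/-- RH-FREE. **The explicit index-wise majorant**: for every `n ≥ 8`,
`|λ(n)| ≤ R(n) = √(2/(4n+1))·√(4π(2n(2n+1) + 39.48 + ½)) / ∏_{k<n} ã_k(n)`.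
Proof: the Legendre coefficients `u_k = ∫ φ_n P_{2k}` obey Bouwkamp's recurrence
(`legInt_recurrence`) whose ratios exceed `a_k(n)` by Wang's `χ > 2n(2n+1)`; forward growth
(`abs_mul_prod_atilde_le`) and Cauchy–Schwarz give `|∫φ_n| ∏ã_k ≤ |u_n| ≤ √(2/(4n+1))`; and
`λ(n) = (∫φ_n)/φ_n(0)` with `φ_n(0) ≥ (4π(χ+½))^{-1/2}` (`sq_apply_zero_ge`, `χ < 2n(2n+1) + 4π²`).
[cite: RokhlinXiao2007, §4 (Legendre-coefficient analysis of `ψ_n`); Osipov2013, Thm. 33 (explicit super-exponential bounds for `|λ_n|`); WangLL2010, Lemma 2.2; ConnesConsani2021, §4 p. 16 (arXiv p0016:L22–L25, the `λ(n)`)] -/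
theorem abs_prolateEigen_le_prolateEigenMajorant {n : ℕ} (hn : 8 ≤ n) :
    |prolateEigen n| ≤ prolateEigenMajorant n := by
  unfold prolateEigenMajorant
  set f := prolateFun n with hfdef
  have hf : IsProlateFunction 1 (2 * n) f := isProlateFunction_prolateFun n
  obtain ⟨χ, hχ⟩ := hf.eigen
  have hlo' := hf.lt_eigen hχ
  have hhi' := hf.eigen_lt hχ
  push_cast at hlo' hhi'
  have hlo : 2 * (n : ℝ) * (2 * n + 1) < χ := by linarith
  have hhi : χ < 2 * (n : ℝ) * (2 * n + 1) + 4 * π ^ 2 := by nlinarith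
  have hn' : (8 : ℝ) ≤ n := by exact_mod_cast hn
  -- the Legendre coefficients at even indices and their recurrence
  set u : ℕ → ℝ := fun k ↦ legInt f (2 * k) with hu
  set α : ℕ → ℝ := fun k ↦
    (χ - 2 * (k : ℝ) * (2 * k + 1) - 4 * π ^ 2 * legB (2 * k)) / (4 * π ^ 2 * legA (2 * k)) with hα
  have hrec : ∀ k, 1 ≤ k → u (k + 1) = α k * u k - prolateBeta k * u (k - 1) := by
    intro k _
    have h := legInt_recurrence hf hχ (2 * k)
    push_cast at h
    have hA := legA_pos (2 * k)
    have hπ : 0 < 4 * π ^ 2 := by positivity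
    simp only [hu, hα, prolateBeta, show 2 * (k + 1) = 2 * k + 2 by ring,
      show 2 * (k - 1) = 2 * k - 2 by omega]
    field_simp
    linarith
  have h1 : u 1 = α 0 * u 0 := by
    have h := legInt_recurrence hf hχ 0
    simp only [Nat.cast_zero, legC_zero] at h
    have hA := legA_pos 0
    have hπ : 0 < 4 * π ^ 2 := by positivity
    simp only [hu, hα, Nat.mul_zero, Nat.mul_one, Nat.cast_zero]
    field_simp
    linarith
  -- forward growth
  have hapos : ∀ k < n, 0 < prolateAtilde n k := fun k hk ↦ prolateAtilde_pos hn hk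
  have ha : ∀ k < n, prolateAlphaLB n k ≤ α k := by
    intro k hk
    have hak : 0 < prolateAlphaLB n k := by
      have h1 := atilde_le (prolateAlphaLB n) prolateBeta prolateBeta_nonneg (k := k)
        (fun j hj ↦ hapos j (hj.trans hk))
      exact lt_of_lt_of_le (hapos k hk) h1
    exact prolateAlphaLB_le_alpha hlo hak
  have hgrow : |u 0| * ∏ k ∈ Finset.range n, prolateAtilde n k ≤ |u n| :=
    abs_mul_prod_atilde_le (K := n) h1 hrec prolateBeta_nonneg ha hapos
  have hP := prod_prolateAtilde_pos hn
  -- `|u n| ≤ √(2/(4n+1))`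
  have hCS : |u n| ≤ Real.sqrt (2 / (4 * n + 1)) := by
    have := abs_legInt_le hf (2 * n)
    simp only [hu]
    convert this using 2
    push_cast; ring
  have hu0 : |u 0| ≤ Real.sqrt (2 / (4 * n + 1)) / ∏ k ∈ Finset.range n, prolateAtilde n k := by
    rw [le_div_iff₀ hP]; exact hgrow.trans hCS
  -- `φ(0)² ≥ 1/(4π(2n(2n+1) + Q + 1/2))`
  have hc : 4 * π ^ 2 ≤ χ + 1 / 4 := by nlinarith [Real.pi_lt_four, Real.pi_pos]
  have h0 := sq_apply_zero_ge hf hχ hc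
  have hf0 : 0 < f 0 := prolateFun_zero_pos n
  have hQ := four_pi_sq_le_fourPiSqUB
  set S : ℝ := 4 * π * (2 * n * (2 * n + 1) + fourPiSqUB + 1 / 2) with hS
  have hSpos : 0 < S := by rw [hS, fourPiSqUB]; positivity
  have hχp : 0 < 4 * π * (χ + 1 / 2) := by
    have : 0 < χ := lt_of_le_of_lt (by positivity) hlo
    positivity
  have hS1 : 1 / S ≤ f 0 ^ 2 := by
    refine le_trans ?_ h0
    apply one_div_le_one_div_of_le hχp
    rw [hS]; nlinarith [Real.pi_pos]
  have h2 : 1 ≤ f 0 ^ 2 * S := (div_le_iff₀ hSpos).1 hS1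
  have hsqS : 1 ≤ Real.sqrt S * f 0 := by
    by_contra h
    push Not at h
    nlinarith [Real.sq_sqrt hSpos.le, mul_nonneg (Real.sqrt_nonneg S) hf0.le]
  -- assemble
  have hlam : prolateEigen n = u 0 / f 0 := by
    rw [prolateEigen_eq_intervalIntegral]
    simp [hu, legInt_zero, hfdef]
  rw [hlam, abs_div, abs_of_pos hf0, div_le_iff₀ hf0]
  calc |u 0| ≤ Real.sqrt (2 / (4 * n + 1)) / ∏ k ∈ Finset.range n, prolateAtilde n k := hu0
    _ = Real.sqrt (2 / (4 * n + 1)) / (∏ k ∈ Finset.range n, prolateAtilde n k) * 1 := by ring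
    _ ≤ Real.sqrt (2 / (4 * n + 1)) / (∏ k ∈ Finset.range n, prolateAtilde n k) *
          (Real.sqrt S * f 0) := mul_le_mul_of_nonneg_left hsqS (by positivity)
    _ = Real.sqrt (2 / (4 * n + 1)) * Real.sqrt S / (∏ k ∈ Finset.range n, prolateAtilde n k) *
          f 0 := by ring

end Literature.NumberTheory.ConnesConsani2021

end
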